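import Mathlib
import Summits.NavierStokesRegularity.NavierStokesRegularity.Theorems.SubOnsagerCeilingKPSideBranchClassDynamics
import Summits.NavierStokesRegularity.NavierStokesRegularity.Theorems.SubOnsagerCeilingKPFluxBudget
import Summits.NavierStokesRegularity.NavierStokesRegularity.Theorems.SubOnsagerCeilingKPSharedPocketStarvation
import HarnessLib

/-!
# STARVED NETWORKS WITH A SHARED LEAK POCKET — mechanism file (energy starvation, class-wide leak form; part 1 of 2)
# (helper file for the crux `SubOnsagerCeiling.ForwardTailCeilingKP`, stmt-NavierStokesRegularity-27057, `--supports`)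

THE LEAK-POCKET CLASS (def-free, by coefficient hypotheses on a KP network proper `α ∈ E₂(R)`: symmetric, cancelling, orthant, diagonal
feeds): the live modes `0, 1, 2` carry an ARBITRARY diagonal forward network among themselves (weights `w_{ae} = α a a e (0,0,1) ≥ 0`,
merging allowed) AND leak diagonally, one shell up, into the COMMON dead-end pocket `3` (weights `W_a = α a a 3 (0,0,1) ≥ 0`); the pocket
feeds nothing and there is NO in-shell coupling at all.  Companion of `Theorems/SubOnsagerCeilingKPSharedPocket*.lean` (in-shell pumps into
the shared pocket); strength hypothesis here: `ρ·w_{ae} ≤ W_a` for all `a` and all live `e`.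

* `leakPocket_quadTerm_pocket`, `leakPocket_quadTerm_live` — closed forms (`quadTerm₃(n) = Λ_{n-1} Σ_a W_a x²_{a,n-1}`; for `e ≠ 3`,
  `quadTerm_e(n) = Λ_{n-1}Σ_a w_{ae}x²_{a,n-1} − Λₙ x_{e,n}Σ_j α e e j (0,0,1) x_{j,n+1}`);
* `leakPocket_pocket_ge` — the SAME-SHELL comparison `ρ·x_{e,N} ≤ x_{3,N}` on `[0,s]` for every live `e` and `N ≥ 1` (pocket and live
  mode are fed by the squares of shell `N-1` with weights `W_a ≥ ρ w_{ae}`; the pocket only accumulates).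

The sequel `Theorems/SubOnsagerCeilingKPLeakPocketBarrier.lean` turns this into starved gate fluxes and `ShellBarrierAt R ε₀ α` with
`(1+ε₀)^{2θ} = 1 + ρκ` at EVERY scale ratio, where `κ·(Σ_j w_{aj} − W_a) ≤ W_a` (leaks at least `κ ×` the live forward weight).
HONEST FRAMING: statements about Tao-type MODEL lattice ODEs (route SubOnsagerCeiling, rung TL-M2Break); one architecture class; no stub,
crux or summit is proved and nothing here bears on Navier–Stokes regularity. [cite: Tao2016AveragedNS, §4 (4.2)–(4.3), (4.8), (4.13)]
[cite: Teschl2012, §2.4 (Grönwall)]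
-/

noncomputable section

-- the sub-problem namespace `NavierStokesRegularity.NavierStokesRegularity` is the tree's layout (D-0017)
set_option linter.dupNamespace false

namespace Summit.NavierStokesRegularity.NavierStokesRegularity.Theorems

open Set Finset MeasureTheory intervalIntegral
open scoped Topology
open Literature.Analysis.FluidPDE.TaoCascade

section LeakPocket

variable {α : Fin 4 → Fin 4 → Fin 4 → ℤ × ℤ × ℤ → ℝ}
  (hs : IsSymmetricCoeff α) (hc : IsCancellingCoeff α)
  (hO : ∀ (Y : Fin 4 → ℤ → ℝ → ℝ) (τ : ℝ), (∀ (j : Fin 4) (k : ℤ), 1 ≤ k → 0 ≤ Y j k τ) →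
    ∀ δ : ℝ, 0 < δ → ∀ (i : Fin 4) (n : ℤ), 1 ≤ n → Y i n τ = 0 → 0 ≤ quadTerm δ α Y i n τ)
  (hD : ∀ a b i : Fin 4, a ≠ b → α a b i (0, 0, 1) = 0)
  (h3w : ∀ e : Fin 4, α 3 3 e (0, 0, 1) = 0)
  (hIn : ∀ a b i : Fin 4, α a b i (0, 0, 0) = 0)
include hs hc hO hD h3w hIn

omit hs hc hO hD h3w in
/-- No in-shell coupling: the in-shell quadratic forms vanish. [this file] -/
theorem leakPocket_inShell (y : Fin 4 → ℝ) (i : Fin 4) : ∑ a, ∑ b, α a b i (0, 0, 0) * (y a * y b) = 0 := by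
  simp [hIn]

omit h3w in
/-- **Any mode** (no in-shell coupling): `quadTerm_i(n) = Λ_{n-1}Σ_a w_{ai}x²_{a,n-1} − Λₙ x_{i,n}Σ_j w_{ij}x_{j,n+1}`. [this file] -/
theorem leakPocket_quadTerm_live (ε₀ : ℝ) (X : Fin 4 → ℤ → ℝ → ℝ) (i : Fin 4) (n : ℤ) (t : ℝ) :
    quadTerm ε₀ α X i n t =
      (1 + ε₀) ^ ((5 : ℝ) * ((n : ℝ) - 1) / 2) * ∑ a, α a a i (0, 0, 1) * X a (n - 1) t ^ 2 -
        (1 + ε₀) ^ ((5 : ℝ) * n / 2) * (X i n t * ∑ j, α i i j (0, 0, 1) * X j (n + 1) t) := by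
  rw [kpProper_quadTerm hs hc hO hD, leakPocket_inShell hIn (fun j => X j n t) i]
  simp

/-- **The pocket**: `quadTerm₃(n) = Λ_{n-1} Σ_a W_a x²_{a,n-1}` (fed by the leaks, feeds nothing). [this file] -/
theorem leakPocket_quadTerm_pocket (ε₀ : ℝ) (X : Fin 4 → ℤ → ℝ → ℝ) (n : ℤ) (t : ℝ) :
    quadTerm ε₀ α X 3 n t = (1 + ε₀) ^ ((5 : ℝ) * ((n : ℝ) - 1) / 2) * ∑ a, α a a 3 (0, 0, 1) * X a (n - 1) t ^ 2 := by
  rw [leakPocket_quadTerm_live hs hc hO hD hIn, sharedPocket_drain_pocket h3w (fun j => X j (n + 1) t)]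
  simp

/-- **The shared leak pocket dominates every live amplitude of the same shell**: along an honest non-negative `ν`-viscous solution from a
one-shell datum (`ε₀ ≥ 0`, `ρ ≥ 0`, `ρ·w_{ae} ≤ W_a` for all `a` and live `e`), for every live `e ≠ 3`, every shell `N ≥ 1` and
`t ∈ [0,s]`: `ρ·x_{e,N}(t) ≤ x_{3,N}(t)`. [cite: Teschl2012, §2.4 (Grönwall)] -/
theorem leakPocket_pocket_ge {ε₀ ν s ρ : ℝ} (hε : 0 ≤ ε₀) (hρ0 : 0 ≤ ρ)
    (hρ : ∀ a e : Fin 4, e ≠ 3 → ρ * α a a e (0, 0, 1) ≤ α a a 3 (0, 0, 1))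
    {X₀ : Fin 4 → ℝ} {X : Fin 4 → ℤ → ℝ → ℝ}
    (hdat : ∀ (i : Fin 4) (k : ℤ), X i k 0 = if k = 0 then X₀ i else 0)
    (hode : ∀ (i : Fin 4) (k : ℤ), ∀ t ∈ Icc (0 : ℝ) s, HasDerivWithinAt (X i k)
      (quadTerm ε₀ α X i k t - ν * (1 + ε₀) ^ ((2 : ℝ) * k) * X i k t) (Icc (0 : ℝ) s) t)
    (hnn : ∀ t ∈ Icc (0 : ℝ) s, ∀ (i : Fin 4) (k : ℤ), 1 ≤ k → 0 ≤ X i k t)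
    {e : Fin 4} (he : e ≠ 3) {N : ℤ} (hN : 1 ≤ N) :
    ∀ t ∈ Icc (0 : ℝ) s, ρ * X e N t ≤ X 3 N t := by
  have hw0 : ∀ a i : Fin 4, 0 ≤ α a a i (0, 0, 1) := fun a i => kpProper_feed_nonneg hO a i
  set κ : ℝ := ν * (1 + ε₀) ^ ((2 : ℝ) * N) with hκ
  set Dr : ℝ → ℝ := fun τ => ∑ j, α e e j (0, 0, 1) * X j (N + 1) τ with hDr
  have hDrnn : ∀ τ ∈ Icc (0 : ℝ) s, 0 ≤ Dr τ := fun τ hτ =>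
    Finset.sum_nonneg fun j _ => mul_nonneg (hw0 e j) (hnn τ hτ j _ (by omega))
  set u : ℝ → ℝ := fun τ => X 3 N τ - ρ * X e N τ with hu
  set u' : ℝ → ℝ := fun τ =>
    ((1 + ε₀) ^ ((5 : ℝ) * ((N : ℝ) - 1) / 2) * (∑ a, α a a 3 (0, 0, 1) * X a (N - 1) τ ^ 2) - κ * X 3 N τ) -
      ρ * ((1 + ε₀) ^ ((5 : ℝ) * ((N : ℝ) - 1) / 2) * (∑ a, α a a e (0, 0, 1) * X a (N - 1) τ ^ 2) -
        (1 + ε₀) ^ ((5 : ℝ) * N / 2) * (X e N τ * Dr τ) - κ * X e N τ) with hu'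
  have hud : ∀ τ ∈ Icc (0 : ℝ) s, HasDerivWithinAt u (u' τ) (Icc 0 s) τ := by
    intro τ hτ
    have h1 := hode 3 N τ hτ
    rw [leakPocket_quadTerm_pocket hs hc hO hD h3w hIn] at h1
    have h0 := hode e N τ hτ
    rw [leakPocket_quadTerm_live hs hc hO hD hIn] at h0
    exact h1.sub (h0.const_mul ρ)
  have hkey : ∀ τ ∈ Icc (0 : ℝ) s, 0 ≤ u' τ + κ * u τ := by
    intro τ hτ
    have hx : 0 ≤ X e N τ := hnn τ hτ e _ hN
    have hΛ : 0 ≤ (1 + ε₀) ^ ((5 : ℝ) * ((N : ℝ) - 1) / 2) := Real.rpow_nonneg (by linarith) _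
    have hΛ' : 0 ≤ (1 + ε₀) ^ ((5 : ℝ) * N / 2) := Real.rpow_nonneg (by linarith) _
    have hdrive : ρ * ∑ a, α a a e (0, 0, 1) * X a (N - 1) τ ^ 2 ≤ ∑ a, α a a 3 (0, 0, 1) * X a (N - 1) τ ^ 2 := by
      rw [Finset.mul_sum]
      refine Finset.sum_le_sum fun a _ => ?_
      have := mul_le_mul_of_nonneg_right (hρ a e he) (sq_nonneg (X a (N - 1) τ))
      linarith [this]
    have hsimp : u' τ + κ * u τ =
        (1 + ε₀) ^ ((5 : ℝ) * ((N : ℝ) - 1) / 2) *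
            (∑ a, α a a 3 (0, 0, 1) * X a (N - 1) τ ^ 2 - ρ * ∑ a, α a a e (0, 0, 1) * X a (N - 1) τ ^ 2) +
          ρ * ((1 + ε₀) ^ ((5 : ℝ) * N / 2) * (X e N τ * Dr τ)) := by
      simp only [hu, hu']
      ring
    rw [hsimp]
    have h1 : 0 ≤ (1 + ε₀) ^ ((5 : ℝ) * ((N : ℝ) - 1) / 2) *
        (∑ a, α a a 3 (0, 0, 1) * X a (N - 1) τ ^ 2 - ρ * ∑ a, α a a e (0, 0, 1) * X a (N - 1) τ ^ 2) :=
      mul_nonneg hΛ (by linarith)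
    have h2 : 0 ≤ ρ * ((1 + ε₀) ^ ((5 : ℝ) * N / 2) * (X e N τ * Dr τ)) :=
      mul_nonneg hρ0 (mul_nonneg hΛ' (mul_nonneg hx (hDrnn τ hτ)))
    linarith
  set G : ℝ → ℝ := fun τ => Real.exp (κ * τ) * u τ with hG
  set G' : ℝ → ℝ := fun τ => Real.exp (κ * τ) * (u' τ + κ * u τ) with hG'
  have hGd : ∀ τ ∈ Icc (0 : ℝ) s, HasDerivWithinAt G (G' τ) (Icc 0 s) τ := by
    intro τ hτ
    have hexp : HasDerivWithinAt (fun θ => Real.exp (κ * θ)) (Real.exp (κ * τ) * κ) (Icc 0 s) τ := by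
      have := ((hasDerivAt_id τ).const_mul κ).exp
      simpa using this.hasDerivWithinAt
    have h := hexp.mul (hud τ hτ)
    refine h.congr_deriv ?_
    simp only [hG']
    ring
  have hGmono : MonotoneOn G (Icc 0 s) := by
    have hGcont : ContinuousOn G (Icc 0 s) := fun τ hτ => (hGd τ hτ).continuousWithinAt
    refine monotoneOn_of_hasDerivWithinAt_nonneg (f' := G') (convex_Icc 0 s) hGcont ?_ ?_
    · intro x hx
      rw [interior_Icc] at hx ⊢
      exact (hGd x (Ioo_subset_Icc_self hx)).mono Ioo_subset_Icc_self
    · intro x hx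
      rw [interior_Icc] at hx
      exact mul_nonneg (Real.exp_pos _).le (hkey x (Ioo_subset_Icc_self hx))
  have hG0 : G 0 = 0 := by
    have h1 : X 3 N 0 = 0 := by rw [hdat]; simp; omega
    have h2 : X e N 0 = 0 := by rw [hdat]; simp; omega
    simp [hG, hu, h1, h2]
  intro t ht
  have hGt : 0 ≤ G t := by
    rw [← hG0]
    exact hGmono ⟨le_rfl, ht.1.trans ht.2⟩ ht ht.1
  have hexp : 0 < Real.exp (κ * t) := Real.exp_pos _
  have hut : 0 ≤ u t := by
    by_contra hh
    push Not at hh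
    have : G t < 0 := by simp only [hG]; nlinarith [mul_pos hexp (neg_pos.2 hh)]
    linarith
  simp only [hu] at hut
  linarith

end LeakPocket

end Summit.NavierStokesRegularity.NavierStokesRegularity.Theorems

end
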